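import Literature.NumberTheory.Automorphic.WeaklyRegularGaloisRep
import Literature.NumberTheory.Automorphic.AsaiSignCont
import HarnessLib

/-!
# Fakhruddin–Pilloni, Theorem 9.10, with oddness in the continuation-form currency

`WeaklyRegularGaloisRep.lean` renders the oddness hypothesis of Fakhruddin–Pilloni's Theorem 9.10
("`π` odd": `L(s, π, Asai^{(-1)^{n-1}})` has a pole at `s = 1`) as the RAW partial-Euler-product pole
`HasAsaiSign π c 1` of `AsaiSign.lean`.  This file records the SAME printed theorem with oddness
rendered by `HasAsaiSignCont π c 1` (`AsaiSignCont.lean`: the continued partial Asai `L`-function has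
its simple pole at `s = 1`, together with the standard analytic package — multipliability of the
partial Euler products on a right half-plane, holomorphic continuation to `{1/2 < Re s}` away from the
pole, non-vanishing at `s = 1` — all of which hold for cuspidal `π` (Flicker 1988; Shahidi 1981,
Thm. 5.1; Grbac–Shahidi 2015, Thm. 4.3), so that as a HYPOTHESIS the rendering is weaker than print
exactly where it may be).  Purpose: the consumers of Theorem 9.10 in line `one-transparent-pane` of
the crux `Summit.Langlands.Langlands.Theses.QuadraticWindow.HostInducedRep` produce the sign from
Mok's pole dichotomy in continuation form (`Mok2014_partialAsaiL_continuation_pole_dichotomy`); with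
this rendering the whole chain runs in one currency and no Ramanujan-strength hypothesis on raw Euler
products is needed (see the module docstring of `AsaiSignContinuation.lean`).

The usual caveat on these renderings: the paper's `π` is a genuine cuspidal automorphic
representation; the tree's `CuspidalAutomorphicRepData` records the Borel–Jacquet datum with Satake
parameters and infinity type, and the conclusion is stated, as in `WeaklyRegularGaloisRep.lean`, without
the polarisation clause.
-/

open scoped NumberField
open NumberField IsDedekindDomain

namespace Literature.NumberTheory.Automorphic

/-- **Fakhruddin–Pilloni, Theorem 9.10** (Galois representations in the weakly regular odd case; CM
field, `χ = 1`), continuation-form currency.  Printed: "Let `π` be a weakly regular, algebraic, odd,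
(essentially) conjugate self dual, cuspidal automorphic representation of `GL_n / L`. In particular,
`π^c = π^∨ ⊗ χ`. There is a continuous Galois representation `ρ_{π,ι} : G_L → GL_n(ℚ̄_p)` such that:
… `ρ_{π,ι}` is unramified at all finite places `v ∤ p` for which `π_v` is unramified and one has
`WD(ρ_{π,ι}|_{G_{F_v}})^{F-ss} = rec(π_v ⊗ |det|_v^{(1-n)/2})`."  Rendering: exactly
`FakhruddinPilloni2021_galoisRep_of_weaklyRegular_odd` with the oddness hypothesis
`HasAsaiSign π c 1` replaced by `HasAsaiSignCont π c 1` (`AsaiSignCont.lean`): `K` CM, `π` cuspidal with a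
C-algebraic weakly regular infinity type, `π^c ≅ π^∨` (`IsEssConjSelfDual π 1`), odd; conclusion: for
every `ℓ` and `ι : ℚ̄_ℓ ≃+* ℂ` a continuous `r : Γ_K → GL_n(ℚ̄_ℓ)` unramified at every finite `v ∤ ℓ`
where `π` has Satake parameter `α`, with arithmetic-Frobenius characteristic polynomial
`arithFrobPolyOfSatake ι q_v n α`.  Named fact (D-0014), not proved here.
[cite: FakhruddinPilloni2021, Thm. 9.10] -/
def FakhruddinPilloni2021_galoisRep_of_weaklyRegular_oddCont : Prop :=
  ∀ (n : ℕ) (K : Type) [Field K] [NumberField K] [IsCMField K]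
    (hcpt : isCompact_glFiniteIntegralLevel n K) (π : CuspidalAutomorphicRepData n K hcpt)
    (T : InfinityType K n), π.1.HasInfinityType T → T.IsCAlgebraic → T.IsWeaklyRegular →
      π.1.IsEssConjSelfDual 1 → π.1.HasAsaiSignCont (NumberField.IsCMField.complexConj K) 1 →
        ∀ (ℓ : ℕ) [Fact ℓ.Prime] (ι : PadicAlgCl ℓ ≃+* ℂ),
          ∃ r : GaloisRepresentations.FramedGaloisRep K (PadicAlgCl ℓ) n,
            ∀ (v : HeightOneSpectrum (𝓞 K)) (α : Multiset ℂ), π.1.HasSatakeParamAt v α →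
              ((ℓ : ℕ) : 𝓞 K) ∉ v.asIdeal →
                r.IsUnramifiedAt v ∧
                  r.HasFrobCharpolyAt v (arithFrobPolyOfSatake ι v.residueCard n α)

end Literature.NumberTheory.Automorphic
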